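import Mathlib
import HarnessLib
import Literature.Probability.LatticeModels.TorusGreenHessianDecay

/-!
# Tree-level ratio floor — the transverse propagator as a Hessian of the torus Green function

Helper for stub `stub_treeRatioFloor` (crux stmt-QuantumFields-9365, line coupling-cubic-response).
The zero-mode-free transverse propagator of the `(0,1)`-plaquette field,
`F(z) = ∑_{k ≠ 0} (ε₀+ε₁)/(ε₀+ε₁+ε₂+ε₃) cos(p_k·z)`, `εᵢ = 2 - 2cos(2πkᵢ/L)`, is (minus `L⁴/2` times) the
sum of the two diagonal second differences `∇₀⁺∇₀⁻ + ∇₁⁺∇₁⁻` of the torus Green function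
`torusGreen` of `Literature/Probability/LatticeModels/LatticeGreenFunction.lean` (`weightSum_eq_hessian`,
from the tree's `torusGreen_hessian_eq` at `S = 0`).  The tree's discrete Calderón–Zygmund estimate
`torusGreen_hessian_mul_dist_pow_four_le` (`|∇∇ torusGreen(z)| dist(0,z)⁴ ≤ C`, uniform in `L`) then bounds
the axis value: `F(n e₂) ≤ C L⁴/n⁴` for `1 ≤ n`, `8n ≤ L` (`axisSum_le`, registered helper stub
`TreeAxisPropagatorBound`).
-/

noncomputable section

namespace Summit.QuantumFields.YangMills.Theorems.FemtoCurvatureSkewness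

open Finset Literature.Probability.LatticeModels
open scoped BigOperators ComplexConjugate

namespace TreeRatio

variable {L : ℕ} [NeZero L]

/-- `Re[χ (v - 1)(1 - conj v)] = (2 Re v - 2) Re χ` for `‖v‖ = 1`. -/
theorem re_mul_sub_one_mul (χ v : ℂ) (hv : ‖v‖ = 1) :
    (χ * (v - 1) * (1 - conj v)).re = (2 * v.re - 2) * χ.re := by
  have h : v.re ^ 2 + v.im ^ 2 = 1 := by
    have h1 : Complex.normSq v = 1 := by rw [Complex.normSq_eq_norm_sq, hv, one_pow]
    rw [Complex.normSq_apply] at h1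
    nlinarith
  simp only [Complex.mul_re, Complex.mul_im, Complex.sub_re, Complex.sub_im, Complex.one_re,
    Complex.one_im, Complex.conj_re, Complex.conj_im]
  linear_combination (-χ.re) * h

/-- The diagonal second difference of the torus Green function as a Fourier sum:
`∇ᵢ⁺∇ᵢ⁻ torusGreen(z) = -L⁻⁴ ∑_{k ≠ 0} (2 - 2cos p_{k,i}) cos(p_k·z)/ε(p_k)`. -/
theorem hessian_diag_eq (z : TorusSite 4 L) (i : Fin 4) :
    torusGreen (z + Pi.single i 1) - torusGreen (z + Pi.single i 1 - Pi.single i 1) -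
        torusGreen z + torusGreen (z - Pi.single i 1) =
      -(∑ k ∈ (univ : Finset (TorusSite 4 L)).erase 0,
        (2 - 2 * Real.cos (2 * Real.pi * ((k i).val : ℝ) / L)) *
          Real.cos (∑ μ, latticeMomentum L k μ * ((z μ).val : ℝ)) / dispersion (latticeMomentum L k)) /
        (L : ℝ) ^ 4 := by
  rw [torusGreen_hessian_eq z i i 0, intervalIntegral.integral_same, zero_add]
  congr 1
  rw [← Finset.sum_neg_distrib]
  refine Finset.sum_congr rfl fun k _ => ?_
  rw [zero_mul, neg_zero, Real.exp_zero, re_mul_sub_one_mul _ _ (norm_torusChar k _),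
    torusChar_single_eq_stdAddChar, re_stdAddChar, torusChar_re]
  ring

/-- **The transverse propagator is a Hessian of the torus Green function**:
`∑_{k ≠ 0} (ε₀+ε₁)/(ε₀+ε₁+ε₂+ε₃) cos(p_k·z) = -(L⁴/2) (∇₀⁺∇₀⁻ + ∇₁⁺∇₁⁻) torusGreen (z)`. -/
theorem weightSum_eq_hessian (z : TorusSite 4 L) :
    ∑ k : Fin 4 → ZMod L,
      (if k = 0 then 0 else ((2 - 2 * Real.cos (2 * Real.pi * ((k 0).val : ℝ) / L)) +
          (2 - 2 * Real.cos (2 * Real.pi * ((k 1).val : ℝ) / L))) /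
        ((2 - 2 * Real.cos (2 * Real.pi * ((k 0).val : ℝ) / L)) + (2 - 2 * Real.cos (2 * Real.pi * ((k 1).val : ℝ) / L)) +
          (2 - 2 * Real.cos (2 * Real.pi * ((k 2).val : ℝ) / L)) + (2 - 2 * Real.cos (2 * Real.pi * ((k 3).val : ℝ) / L)))) *
        Real.cos (∑ μ, latticeMomentum L k μ * ((z μ).val : ℝ)) =
      -((L : ℝ) ^ 4 / 2) *
        ((torusGreen (z + Pi.single 0 1) - torusGreen (z + Pi.single 0 1 - Pi.single 0 1) -
            torusGreen z + torusGreen (z - Pi.single 0 1)) +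
          (torusGreen (z + Pi.single 1 1) - torusGreen (z + Pi.single 1 1 - Pi.single 1 1) -
            torusGreen z + torusGreen (z - Pi.single 1 1))) := by
  have hL : (L : ℝ) ≠ 0 := Nat.cast_ne_zero.mpr (NeZero.ne L)
  rw [hessian_diag_eq, hessian_diag_eq, ← Finset.add_sum_erase _ _ (Finset.mem_univ (0 : TorusSite 4 L)),
    if_pos rfl, zero_mul, zero_add]
  have e : -((L : ℝ) ^ 4 / 2) * (-(∑ k ∈ (univ : Finset (TorusSite 4 L)).erase 0,
      (2 - 2 * Real.cos (2 * Real.pi * ((k 0).val : ℝ) / L)) *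
        Real.cos (∑ μ, latticeMomentum L k μ * ((z μ).val : ℝ)) / dispersion (latticeMomentum L k)) / (L : ℝ) ^ 4 +
      -(∑ k ∈ (univ : Finset (TorusSite 4 L)).erase 0,
      (2 - 2 * Real.cos (2 * Real.pi * ((k 1).val : ℝ) / L)) *
        Real.cos (∑ μ, latticeMomentum L k μ * ((z μ).val : ℝ)) / dispersion (latticeMomentum L k)) / (L : ℝ) ^ 4) =
      ∑ k ∈ (univ : Finset (TorusSite 4 L)).erase 0, (1 / 2) *
        (((2 - 2 * Real.cos (2 * Real.pi * ((k 0).val : ℝ) / L)) *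
          Real.cos (∑ μ, latticeMomentum L k μ * ((z μ).val : ℝ)) / dispersion (latticeMomentum L k)) +
        ((2 - 2 * Real.cos (2 * Real.pi * ((k 1).val : ℝ) / L)) *
          Real.cos (∑ μ, latticeMomentum L k μ * ((z μ).val : ℝ)) / dispersion (latticeMomentum L k))) := by
    rw [← Finset.mul_sum, Finset.sum_add_distrib]
    field_simp
    ring
  rw [e]
  refine Finset.sum_congr rfl fun k hk => ?_
  have hk0 : k ≠ 0 := Finset.ne_of_mem_erase hk
  rw [if_neg hk0]
  have hd : dispersion (latticeMomentum L k) =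
      ((2 - 2 * Real.cos (2 * Real.pi * ((k 0).val : ℝ) / L)) + (2 - 2 * Real.cos (2 * Real.pi * ((k 1).val : ℝ) / L)) +
        (2 - 2 * Real.cos (2 * Real.pi * ((k 2).val : ℝ) / L)) + (2 - 2 * Real.cos (2 * Real.pi * ((k 3).val : ℝ) / L))) / 2 := by
    simp only [dispersion, latticeMomentum, Fin.sum_univ_four]
    ring
  have hdpos : 0 < dispersion (latticeMomentum L k) := dispersion_latticeMomentum_pos hk0
  rw [hd] at hdpos ⊢
  field_simp

/-- **Decay of the transverse propagator** (from the tree's discrete Calderón–Zygmund estimate):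
`∑_{k ≠ 0} (ε₀+ε₁)/(ε₀+…+ε₃) cos(p_k·z) ≤ C L⁴ / dist(0,z)⁴` for `z ≠ 0`, `dist(0,z)² = ∑_μ z̃_μ²`. -/
theorem weightSum_le : ∃ C : ℝ, 0 < C ∧ ∀ (L : ℕ) [NeZero L] (z : TorusSite 4 L), z ≠ 0 →
    ∑ k : Fin 4 → ZMod L,
      (if k = 0 then 0 else ((2 - 2 * Real.cos (2 * Real.pi * ((k 0).val : ℝ) / L)) +
          (2 - 2 * Real.cos (2 * Real.pi * ((k 1).val : ℝ) / L))) /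
        ((2 - 2 * Real.cos (2 * Real.pi * ((k 0).val : ℝ) / L)) + (2 - 2 * Real.cos (2 * Real.pi * ((k 1).val : ℝ) / L)) +
          (2 - 2 * Real.cos (2 * Real.pi * ((k 2).val : ℝ) / L)) + (2 - 2 * Real.cos (2 * Real.pi * ((k 3).val : ℝ) / L)))) *
        Real.cos (∑ μ, latticeMomentum L k μ * ((z μ).val : ℝ)) ≤
      C * (L : ℝ) ^ 4 / (∑ μ, (((z μ).valMinAbs : ℤ) : ℝ) ^ 2) ^ 2 := by
  obtain ⟨C₀, hC₀⟩ := torusGreen_hessian_mul_dist_pow_four_le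
  refine ⟨max C₀ 1, lt_of_lt_of_le one_pos (le_max_right _ _), fun L _ z hz => ?_⟩
  have hL : (0 : ℝ) < L := by exact_mod_cast NeZero.pos L
  set D : ℝ := ∑ μ, (((z μ).valMinAbs : ℤ) : ℝ) ^ 2 with hD
  -- `D ≥ 1`: some centred coordinate of `z ≠ 0` is a non-zero integer
  have hD1 : 1 ≤ D := by
    obtain ⟨μ, hμ⟩ : ∃ μ, z μ ≠ 0 := by
      by_contra h
      push Not at h
      exact hz (funext h)
    have h1 : (1 : ℝ) ≤ (((z μ).valMinAbs : ℤ) : ℝ) ^ 2 := by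
      have hne : (z μ).valMinAbs ≠ 0 := fun h => hμ ((ZMod.valMinAbs_eq_zero _).mp h)
      have : (1 : ℤ) ≤ (z μ).valMinAbs ^ 2 := by
        have := Int.one_le_abs hne
        nlinarith [sq_abs (z μ).valMinAbs]
      exact_mod_cast this
    calc (1 : ℝ) ≤ (((z μ).valMinAbs : ℤ) : ℝ) ^ 2 := h1
      _ ≤ D := Finset.single_le_sum (f := fun μ => (((z μ).valMinAbs : ℤ) : ℝ) ^ 2)
          (fun μ _ => sq_nonneg _) (Finset.mem_univ μ)
  have hDpos : 0 < D := by linarith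
  have hsq : Real.sqrt D ^ 4 = D ^ 2 := by
    rw [show (4 : ℕ) = 2 * 2 from rfl, pow_mul, Real.sq_sqrt hDpos.le]
  -- the two diagonal Hessians are `≤ C₀ / D²` in absolute value
  have hH : ∀ i : Fin 4, |torusGreen (z + Pi.single i 1) - torusGreen (z + Pi.single i 1 - Pi.single i 1) -
      torusGreen z + torusGreen (z - Pi.single i 1)| ≤ max C₀ 1 / D ^ 2 := by
    intro i
    have h := hC₀ L i i z hz
    rw [hsq] at h
    rw [le_div_iff₀ (by positivity)]
    exact h.trans (le_max_left _ _)
  rw [weightSum_eq_hessian]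
  have h0 := hH 0
  have h1 := hH 1
  rw [abs_le] at h0 h1
  have hL4 : (0 : ℝ) < (L : ℝ) ^ 4 / 2 := by positivity
  calc -((L : ℝ) ^ 4 / 2) * _ ≤ ((L : ℝ) ^ 4 / 2) * (max C₀ 1 / D ^ 2 + max C₀ 1 / D ^ 2) := by
        rw [neg_mul, neg_le, ← mul_neg, neg_add]
        exact mul_le_mul_of_nonneg_left (add_le_add h0.1 h1.1) hL4.le
    _ = max C₀ 1 * (L : ℝ) ^ 4 / D ^ 2 := by ring

/-- **Axis decay of the transverse propagator** (registered helper stub `TreeAxisPropagatorBound`): there is an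
absolute constant `C > 0` with `∑_{k ≠ 0} (ε₀+ε₁)/(ε₀+…+ε₃) cos(2πk₂n/L) ≤ C L⁴/n⁴` for `1 ≤ n`, `8n ≤ L`. -/
theorem axisSum_le : ∃ C : ℝ, 0 < C ∧ ∀ (L n : ℕ) [NeZero L], 1 ≤ n → 8 * n ≤ L →
    ∑ k : Fin 4 → ZMod L,
      (if k = 0 then 0 else ((2 - 2 * Real.cos (2 * Real.pi * ((k 0).val : ℝ) / L)) +
          (2 - 2 * Real.cos (2 * Real.pi * ((k 1).val : ℝ) / L))) /
        ((2 - 2 * Real.cos (2 * Real.pi * ((k 0).val : ℝ) / L)) + (2 - 2 * Real.cos (2 * Real.pi * ((k 1).val : ℝ) / L)) +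
          (2 - 2 * Real.cos (2 * Real.pi * ((k 2).val : ℝ) / L)) + (2 - 2 * Real.cos (2 * Real.pi * ((k 3).val : ℝ) / L)))) *
        Real.cos (2 * Real.pi * ((k 2).val : ℝ) * n / L) ≤
      C * (L : ℝ) ^ 4 / (n : ℝ) ^ 4 := by
  obtain ⟨C, hC, h⟩ := weightSum_le
  refine ⟨C, hC, fun L n _ hn hnL => ?_⟩
  -- the axis point `z = n e₂`
  set z : TorusSite 4 L := Pi.single 2 ((n : ℕ) : ZMod L) with hz
  have hnL' : n < L := by omega
  have hz2 : z 2 = ((n : ℕ) : ZMod L) := by simp [hz]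
  have hzμ : ∀ μ : Fin 4, μ ≠ 2 → z μ = 0 := fun μ hμ => by simp [hz, Pi.single_eq_of_ne hμ]
  have hz0 : z ≠ 0 := by
    intro h0
    have h2 := congr_fun h0 2
    rw [hz2, Pi.zero_apply] at h2
    have := congrArg ZMod.val h2
    rw [ZMod.val_cast_of_lt hnL', ZMod.val_zero] at this
    omega
  have hphase : ∀ k : TorusSite 4 L, Real.cos (∑ μ, latticeMomentum L k μ * ((z μ).val : ℝ)) =
      Real.cos (2 * Real.pi * ((k 2).val : ℝ) * n / L) := by
    intro k
    congr 1
    simp only [Fin.sum_univ_four, latticeMomentum, hz2, hzμ 0 (by decide), hzμ 1 (by decide),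
      hzμ 3 (by decide), ZMod.val_zero, Nat.cast_zero, mul_zero, zero_add, add_zero, ZMod.val_cast_of_lt hnL']
    ring
  have hdist : ∑ μ, (((z μ).valMinAbs : ℤ) : ℝ) ^ 2 = (n : ℝ) ^ 2 := by
    simp only [Fin.sum_univ_four, hz2, hzμ 0 (by decide), hzμ 1 (by decide), hzμ 3 (by decide),
      ZMod.valMinAbs_zero, Int.cast_zero, ZMod.valMinAbs_natCast_of_le_half (show n ≤ L / 2 by omega)]
    push_cast
    ring
  have key := h L z hz0
  simp_rw [hphase] at key
  rw [hdist] at key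
  calc _ ≤ C * (L : ℝ) ^ 4 / ((n : ℝ) ^ 2) ^ 2 := key
    _ = C * (L : ℝ) ^ 4 / (n : ℝ) ^ 4 := by ring

end TreeRatio

/-- **Axis decay of the transverse propagator** (registered helper stub `TreeAxisPropagatorBound` of
stmt-QuantumFields-9365). -/
theorem TreeAxisPropagatorBound : ∃ C : ℝ, 0 < C ∧ ∀ (L n : ℕ) [NeZero L], 1 ≤ n → 8 * n ≤ L →
    ∑ k : Fin 4 → ZMod L,
      (if k = 0 then 0 else ((2 - 2 * Real.cos (2 * Real.pi * ((k 0).val : ℝ) / L)) + (2 - 2 * Real.cos (2 * Real.pi * ((k 1).val : ℝ) / L))) /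
        ((2 - 2 * Real.cos (2 * Real.pi * ((k 0).val : ℝ) / L)) + (2 - 2 * Real.cos (2 * Real.pi * ((k 1).val : ℝ) / L)) +
          (2 - 2 * Real.cos (2 * Real.pi * ((k 2).val : ℝ) / L)) + (2 - 2 * Real.cos (2 * Real.pi * ((k 3).val : ℝ) / L)))) *
        Real.cos (2 * Real.pi * ((k 2).val : ℝ) * n / L) ≤
      C * (L : ℝ) ^ 4 / (n : ℝ) ^ 4 :=
  TreeRatio.axisSum_le

end Summit.QuantumFields.YangMills.Theorems.FemtoCurvatureSkewness

end
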